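import Literature.NumberTheory.EllipticCurves.ShintaniIndefiniteStabilizersA
import Literature.NumberTheory.EllipticCurves.ShintaniOrbitUnfolding
import Literature.NumberTheory.EllipticCurves.Gamma0PlusFreeAction
import Mathlib.NumberTheory.Pell
import Mathlib.GroupTheory.Archimedean
import HarnessLib

/-!
# Stabilisers of indefinite forms, II: in `Γ₀(64)⁺` the stabiliser of an anisotropic vector is infinite cyclic

[[cite: Shintani1975, §2, proof of Prop. 2.3 (pp. 103–104)]] — "`Γ_x` is … an infinite cyclic
group" for `(x, x) > 0` anisotropic: for the twisted lift on `Γ = Γ₀(64)⁺` and `k₀ ∈ ℤ³` with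
`Δ(k₀) = k₁² - 256 k₀ k₂ > 0` not a square, we PROVE that the logarithmic multiplier
`ℓ(γ) = log κ(γ)` (`ShintaniIndefiniteStabilizersA`) is an INJECTIVE homomorphism `Γ_{k₀} → ℝ`
with DISCRETE (only finitely many `γ` with `|ℓ(γ)| ≤ log R`: bounded entries) and NON-TRIVIAL
(the Pell automorph `(t - k₁s, -2k₂s; 128k₀s, t + k₁s)`, `t² - Δs² = 1`, Mathlib
`Pell.exists_of_not_isSquare`, raised into `Γ₀(64)⁺` by finite index) image, hence
`ℓ(Γ_{k₀}) = ℤ r₀` (`AddSubgroup.cyclic_of_min`):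

* **`indef_stabilizer`** — the package used by the unfolding: `M ∈ SL₂(ℝ)` with
  `ι♮(k₀) ∘ M = λXY`, `κ₀ = e^{r₀} > 1` and a bijection `m : Γ_{k₀} → ℤ` with
  `M⁻¹(γ w) = κ₀^{m(γ)} · M⁻¹ w` for all `γ ∈ Γ_{k₀}`.

No named facts; the definitions are `toSLR` (an `abbrev`), `logMult`, `logMultSubgroup`, `intDisc`,
`pellAut` and `slOf`.
-/

noncomputable section

open scoped MatrixGroups ModularForm Modular Topology
open UpperHalfPlane hiding I
open Complex Filter MeasureTheory Set CongruenceSubgroup ModularGroup Real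
open Literature.NumberTheory.EllipticCurves.ModularForms

namespace Literature.NumberTheory.EllipticCurves.Shintani

/-! ### The stabiliser condition in terms of `actSL` -/

/-- `actM γ x = x ↔ actM γ⁻¹ x = x`. [folklore] -/
theorem actM_eq_iff_inv (γ : SL(2, ℤ)) (x : V) : actM γ x = x ↔ actM γ⁻¹ x = x := by
  constructor
  · intro h
    calc actM γ⁻¹ x = actM γ⁻¹ (actM γ x) := by rw [h]
      _ = actM (γ * γ⁻¹) x := actM_actM _ _ _
      _ = x := by rw [mul_inv_cancel, actM_one]
  · intro h
    calc actM γ x = actM γ (actM γ⁻¹ x) := by rw [h]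
      _ = actM (γ⁻¹ * γ) x := actM_actM _ _ _
      _ = x := by rw [inv_mul_cancel, actM_one]

/-- **`γ • k₀ = k₀ ↔ ι♮(k₀) ∘ γ = ι♮(k₀)`** (`γ ∈ Γ₀(64)⁺` as a real matrix). [folklore] -/
theorem smul_eq_iff_actSL (γ : Gamma0Plus 64) (k₀ : Fin 3 → ℤ) :
    γ • k₀ = k₀ ↔ actSL ((γ : SL(2, ℤ)) : SL(2, ℝ)) (latSharp k₀) = latSharp k₀ := by
  rw [actSL_coe, actM_eq_iff_inv, ← latSharp_smul_eq_actM]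
  exact ⟨fun h ↦ by rw [h], fun h ↦ latSharp_injective h⟩

/-! ### Bounded multiplier: bounded entries, finitely many integer elements -/

section Finite

variable {x : V} {M : SL(2, ℝ)} {lam : ℝ}

/-- `|a| ≤ R` from `a² ≤ R` and `R ≥ 1`. [folklore] -/
theorem abs_le_of_sq_le {a R : ℝ} (hR : 1 ≤ R) (h : a ^ 2 ≤ R) : |a| ≤ R := by
  have h2 : a ^ 2 ≤ R ^ 2 := h.trans (by nlinarith)
  have := Real.sqrt_le_sqrt h2
  rwa [Real.sqrt_sq_eq_abs, Real.sqrt_sq (by linarith)] at this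

/-- The entries of a stabilising `g` in terms of the diagonal conjugate: `g = M δ M⁻¹`,
`g_{ij} = M_{i0} δ_{00} (M⁻¹)_{0j} + M_{i1} δ_{11} (M⁻¹)_{1j}`. [folklore] -/
theorem entry_eq_of_actSL_eq (hlam : lam ≠ 0) (hM : actSL M x = xyForm lam) {g : SL(2, ℝ)}
    (hg : actSL g x = x) (i j : Fin 2) :
    (g i j : ℝ) = M i 0 * (M⁻¹ * g * M) 0 0 * (M⁻¹ : SL(2, ℝ)) 0 j +
      M i 1 * (M⁻¹ * g * M) 1 1 * (M⁻¹ : SL(2, ℝ)) 1 j := by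
  obtain ⟨hc, hb⟩ := (actSL_eq_iff_conj hlam hM g).mp hg
  set δ : SL(2, ℝ) := M⁻¹ * g * M with hδ
  have hg' : g = M * δ * M⁻¹ := by rw [hδ]; group
  have e : ∀ i j, ((M * δ * M⁻¹) i j : ℝ) = ∑ k, ∑ l, M i k * δ k l * (M⁻¹ : SL(2, ℝ)) l j := by
    intro i j
    simp only [Matrix.SpecialLinearGroup.coe_mul, Matrix.mul_apply, Finset.sum_mul]
    rw [Finset.sum_comm]
  conv_lhs => rw [hg', e i j]
  simp only [Fin.sum_univ_two]
  rw [hb, hc]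
  ring

/-- **Bounded entries**: a stabilising `g` with `κ(g) ∈ [R⁻¹, R]` (`R ≥ 1`) has
`|g_{ij}| ≤ R (|M_{i0}(M⁻¹)_{0j}| + |M_{i1}(M⁻¹)_{1j}|)`. [folklore] -/
theorem abs_entry_le (hlam : lam ≠ 0) (hM : actSL M x = xyForm lam) {R : ℝ} (hR : 1 ≤ R)
    {g : SL(2, ℝ)} (hg : actSL g x = x) (hk : multK M g ∈ Icc R⁻¹ R) (i j : Fin 2) :
    |(g i j : ℝ)| ≤ R * (|(M i 0 : ℝ) * (M⁻¹ : SL(2, ℝ)) 0 j| + |(M i 1 : ℝ) * (M⁻¹ : SL(2, ℝ)) 1 j|) := by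
  have hdiag := conj_diag_mul hlam hM hg
  set δ : SL(2, ℝ) := M⁻¹ * g * M with hδ
  have hR0 : 0 < R := by linarith
  have hu : |(δ 0 0 : ℝ)| ≤ R := abs_le_of_sq_le hR hk.2
  have hv : |(δ 1 1 : ℝ)| ≤ R := by
    have hu2 : R⁻¹ ≤ (δ 0 0 : ℝ) ^ 2 := hk.1
    have hu0 : (δ 0 0 : ℝ) ≠ 0 := by intro h0; rw [h0, zero_mul] at hdiag; exact zero_ne_one hdiag
    have hv' : (δ 1 1 : ℝ) = (δ 0 0 : ℝ)⁻¹ := by field_simp; linarith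
    refine abs_le_of_sq_le hR ?_
    rw [hv', inv_pow]
    have hpos : 0 < (δ 0 0 : ℝ) ^ 2 := by positivity
    calc ((δ 0 0 : ℝ) ^ 2)⁻¹ ≤ (R⁻¹)⁻¹ := by
          exact inv_anti₀ (by positivity) hu2
      _ = R := inv_inv R
  rw [entry_eq_of_actSL_eq hlam hM hg i j, ← hδ]
  calc |(M i 0 : ℝ) * δ 0 0 * (M⁻¹ : SL(2, ℝ)) 0 j + M i 1 * δ 1 1 * (M⁻¹ : SL(2, ℝ)) 1 j|
      ≤ |(M i 0 : ℝ) * δ 0 0 * (M⁻¹ : SL(2, ℝ)) 0 j| + |(M i 1 : ℝ) * δ 1 1 * (M⁻¹ : SL(2, ℝ)) 1 j| :=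
        abs_add_le _ _
    _ = |(δ 0 0 : ℝ)| * |(M i 0 : ℝ) * (M⁻¹ : SL(2, ℝ)) 0 j| + |(δ 1 1 : ℝ)| * |(M i 1 : ℝ) * (M⁻¹ : SL(2, ℝ)) 1 j| := by
        rw [abs_mul, abs_mul, abs_mul, abs_mul, abs_mul, abs_mul]; ring
    _ ≤ R * |(M i 0 : ℝ) * (M⁻¹ : SL(2, ℝ)) 0 j| + R * |(M i 1 : ℝ) * (M⁻¹ : SL(2, ℝ)) 1 j| := by
        gcongr
    _ = _ := by ring

/-- **Finitely many elements of `Γ₀(64)⁺` stabilise `k₀` with multiplier in `[R⁻¹, R]`.** [folklore] -/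
theorem finite_stab_multK_mem (k₀ : Fin 3 → ℤ) (hlam : lam ≠ 0) (hM : actSL M (latSharp k₀) = xyForm lam)
    {R : ℝ} (hR : 1 ≤ R) :
    {γ : Gamma0Plus 64 | γ • k₀ = k₀ ∧ multK M ((γ : SL(2, ℤ)) : SL(2, ℝ)) ∈ Icc R⁻¹ R}.Finite := by
  -- an entrywise bound `B` and the integer box `[-N, N]`
  set B : ℝ := R * ∑ i : Fin 2, ∑ j : Fin 2,
    (|(M i 0 : ℝ) * (M⁻¹ : SL(2, ℝ)) 0 j| + |(M i 1 : ℝ) * (M⁻¹ : SL(2, ℝ)) 1 j|) with hB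
  set N : ℤ := ⌈B⌉ with hN
  set f : Gamma0Plus 64 → (Fin 2 → Fin 2 → ℤ) := fun γ i j ↦ ((γ : SL(2, ℤ)) i j : ℤ) with hf
  have hinj : Set.InjOn f {γ : Gamma0Plus 64 | γ • k₀ = k₀ ∧ multK M ((γ : SL(2, ℤ)) : SL(2, ℝ)) ∈ Icc R⁻¹ R} := by
    intro γ _ γ' _ h
    apply Subtype.ext
    ext i j
    exact congrFun (congrFun h i) j
  refine Set.Finite.of_finite_image ?_ hinj
  refine Set.Finite.subset (Set.Finite.pi (t := fun _ : Fin 2 ↦ Set.univ.pi (fun _ : Fin 2 ↦ Icc (-N) N))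
    (fun _ ↦ Set.Finite.pi (fun _ ↦ Set.finite_Icc _ _))) ?_
  rintro F ⟨γ, ⟨hγ, hk⟩, rfl⟩
  simp only [Set.mem_pi, Set.mem_univ, true_implies, Set.mem_Icc]
  intro i j
  have hg : actSL ((γ : SL(2, ℤ)) : SL(2, ℝ)) (latSharp k₀) = latSharp k₀ := (smul_eq_iff_actSL γ k₀).mp hγ
  have h := abs_entry_le hlam hM hR hg hk i j
  have hij : |((((γ : SL(2, ℤ)) : SL(2, ℝ)) i j : ℝ))| ≤ B := by
    refine h.trans ?_
    rw [hB]
    refine mul_le_mul_of_nonneg_left ?_ (by linarith)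
    refine (Finset.single_le_sum (f := fun i ↦ ∑ j : Fin 2,
      (|(M i 0 : ℝ) * (M⁻¹ : SL(2, ℝ)) 0 j| + |(M i 1 : ℝ) * (M⁻¹ : SL(2, ℝ)) 1 j|))
      (fun _ _ ↦ Finset.sum_nonneg fun _ _ ↦ by positivity) (Finset.mem_univ i)).trans' ?_
    exact Finset.single_le_sum (f := fun j ↦
      (|(M i 0 : ℝ) * (M⁻¹ : SL(2, ℝ)) 0 j| + |(M i 1 : ℝ) * (M⁻¹ : SL(2, ℝ)) 1 j|))
      (fun _ _ ↦ by positivity) (Finset.mem_univ j)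
  have hcast : ((((γ : SL(2, ℤ)) : SL(2, ℝ)) i j : ℝ)) = (((γ : SL(2, ℤ)) i j : ℤ) : ℝ) := by
    simp [Matrix.SpecialLinearGroup.map_apply_coe]
  rw [hcast] at hij
  have hle := abs_le.mp (hij.trans (Int.le_ceil B))
  constructor
  · have : ((-N : ℤ) : ℝ) ≤ ((γ : SL(2, ℤ)) i j : ℤ) := by push_cast; exact hle.1
    exact_mod_cast this
  · have : (((γ : SL(2, ℤ)) i j : ℤ) : ℝ) ≤ (N : ℝ) := hle.2
    exact_mod_cast this

end Finite

/-! ### The multiplier on the stabiliser: a homomorphism with discrete, hence cyclic, image -/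

/-- Integer matrices with the same real image are equal. [folklore] -/
theorem eq_of_coe_real_eq {γ γ' : SL(2, ℤ)} (h : (γ : SL(2, ℝ)) = (γ' : SL(2, ℝ))) : γ = γ' := by
  ext i j
  have := congrArg (fun g : SL(2, ℝ) ↦ (g i j : ℝ)) h
  simpa [Matrix.SpecialLinearGroup.map_apply_coe] using this

/-- An integer matrix whose real image is `-1` is `-1`. [folklore] -/
theorem eq_neg_one_of_coe_real {γ : SL(2, ℤ)} (h : (γ : SL(2, ℝ)) = -1) : γ = -1 := by
  ext i j
  have := congrArg (fun g : SL(2, ℝ) ↦ (g i j : ℝ)) h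
  simp [Matrix.SpecialLinearGroup.map_apply_coe] at this
  fin_cases i <;> fin_cases j <;> simp at this ⊢ <;> exact_mod_cast this

section Cyclic

variable (k₀ : Fin 3 → ℤ) {M : SL(2, ℝ)} {lam : ℝ}

/-- The real matrix of an element of the stabiliser. [folklore] -/
abbrev toSLR (γ : stabK k₀) : SL(2, ℝ) := (((γ : Gamma0Plus 64) : SL(2, ℤ)) : SL(2, ℝ))

/-- Elements of the stabiliser stabilise the real form. [folklore] -/
theorem actSL_toSLR (γ : stabK k₀) : actSL (toSLR k₀ γ) (latSharp k₀) = latSharp k₀ :=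
  (smul_eq_iff_actSL _ k₀).mp γ.2

/-- `toSLR` is multiplicative. [folklore] -/
theorem toSLR_mul (γ γ' : stabK k₀) : toSLR k₀ (γ * γ') = toSLR k₀ γ * toSLR k₀ γ' := by
  simp [toSLR, map_mul]

/-- `toSLR 1 = 1`. [folklore] -/
theorem toSLR_one : toSLR k₀ 1 = 1 := by simp [toSLR, map_one]

/-- The logarithmic multiplier `ℓ(γ) = log κ(γ)`. [folklore] -/
def logMult (M : SL(2, ℝ)) (γ : stabK k₀) : ℝ := Real.log (multK M (toSLR k₀ γ))

variable (hlam : lam ≠ 0) (hM : actSL M (latSharp k₀) = xyForm lam)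
include hlam hM

/-- `ℓ` is additive. [folklore] -/
theorem logMult_mul (γ γ' : stabK k₀) : logMult k₀ M (γ * γ') = logMult k₀ M γ + logMult k₀ M γ' := by
  unfold logMult
  rw [toSLR_mul, multK_mul hlam hM (actSL_toSLR k₀ γ) (actSL_toSLR k₀ γ'),
    Real.log_mul (multK_pos hlam hM (actSL_toSLR k₀ γ)).ne' (multK_pos hlam hM (actSL_toSLR k₀ γ')).ne']

omit hlam hM in
/-- `ℓ(1) = 0`. [folklore] -/
theorem logMult_one : logMult k₀ M 1 = 0 := by
  unfold logMult multK
  rw [toSLR_one, mul_one, inv_mul_cancel]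
  simp

/-- `ℓ(γ⁻¹) = -ℓ(γ)`. [folklore] -/
theorem logMult_inv (γ : stabK k₀) : logMult k₀ M γ⁻¹ = -logMult k₀ M γ := by
  have h := logMult_mul k₀ hlam hM γ⁻¹ γ
  rw [inv_mul_cancel, logMult_one] at h
  linarith

/-- `κ = exp ℓ`. [folklore] -/
theorem exp_logMult (γ : stabK k₀) : Real.exp (logMult k₀ M γ) = multK M (toSLR k₀ γ) :=
  Real.exp_log (multK_pos hlam hM (actSL_toSLR k₀ γ))

/-- **`ℓ(γ) = 0 ⇒ γ = 1`** (`κ = 1 ⇒ γ = ±1`, and `-1 ∉ Γ₀(64)⁺`). [folklore] -/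
theorem eq_one_of_logMult_eq_zero {γ : stabK k₀} (h : logMult k₀ M γ = 0) : γ = 1 := by
  have hk : multK M (toSLR k₀ γ) = 1 := by rw [← exp_logMult k₀ hlam hM, h, Real.exp_zero]
  rcases eq_one_or_neg_one_of_multK_eq_one hlam hM (actSL_toSLR k₀ γ) hk with h2 | h2
  · apply Subtype.ext; apply Subtype.ext
    have : (((γ : Gamma0Plus 64) : SL(2, ℤ)) : SL(2, ℝ)) = ((1 : SL(2, ℤ)) : SL(2, ℝ)) := by
      rw [map_one]; exact h2
    exact eq_of_coe_real_eq this
  · exfalso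
    have hneg : ((γ : Gamma0Plus 64) : SL(2, ℤ)) = -1 := eq_neg_one_of_coe_real h2
    have hmem := (γ : Gamma0Plus 64).2
    rw [hneg] at hmem
    exact neg_one_not_mem_Gamma0Plus hmem

/-- **`ℓ` is injective.** [folklore] -/
theorem logMult_injective : Function.Injective (logMult k₀ M) := by
  intro γ γ' h
  have h1 : logMult k₀ M (γ * γ'⁻¹) = 0 := by
    rw [logMult_mul k₀ hlam hM, logMult_inv k₀ hlam hM, h]; ring
  have := eq_one_of_logMult_eq_zero k₀ hlam hM h1
  exact mul_inv_eq_one.mp this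

/-- The image `L = ℓ(Γ_{k₀}) ⊆ ℝ` as an additive subgroup. [folklore] -/
def logMultSubgroup (M : SL(2, ℝ)) (hlam : lam ≠ 0) (hM : actSL M (latSharp k₀) = xyForm lam) : AddSubgroup ℝ where
  carrier := Set.range (logMult k₀ M)
  zero_mem' := ⟨1, logMult_one k₀⟩
  add_mem' := by
    rintro _ _ ⟨γ, rfl⟩ ⟨γ', rfl⟩
    exact ⟨γ * γ', logMult_mul k₀ hlam hM γ γ'⟩
  neg_mem' := by
    rintro _ ⟨γ, rfl⟩
    exact ⟨γ⁻¹, logMult_inv k₀ hlam hM γ⟩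

/-- **Discreteness**: for every `R ≥ 1` only finitely many `γ` have `|ℓ(γ)| ≤ log R`. [folklore] -/
theorem finite_abs_logMult_le {R : ℝ} (hR : 1 ≤ R) : {γ : stabK k₀ | |logMult k₀ M γ| ≤ Real.log R}.Finite := by
  have hfin := finite_stab_multK_mem k₀ hlam hM hR
  -- `|log κ| ≤ log R ↔ κ ∈ [R⁻¹, R]`
  have hsub : (fun γ : stabK k₀ ↦ (γ : Gamma0Plus 64)) '' {γ : stabK k₀ | |logMult k₀ M γ| ≤ Real.log R} ⊆
      {γ : Gamma0Plus 64 | γ • k₀ = k₀ ∧ multK M ((γ : SL(2, ℤ)) : SL(2, ℝ)) ∈ Icc R⁻¹ R} := by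
    rintro _ ⟨γ, hγ, rfl⟩
    refine ⟨γ.2, ?_⟩
    have hpos := multK_pos hlam hM (actSL_toSLR k₀ γ)
    have hR0 : 0 < R := by linarith
    simp only [Set.mem_setOf_eq, logMult, abs_le] at hγ
    constructor
    · have h1 : Real.log R⁻¹ ≤ Real.log (multK M (toSLR k₀ γ)) := by rw [Real.log_inv]; exact hγ.1
      exact (Real.log_le_log_iff (by positivity) hpos).mp h1
    · exact (Real.log_le_log_iff hpos hR0).mp hγ.2
  exact Set.Finite.of_finite_image (hfin.subset hsub) (Subtype.val_injective.injOn)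

/-- **The image of `ℓ` is cyclic**: `L = ℤ r₀` for some `r₀ ≥ 0` (`r₀ = 0` iff `L` is trivial).
[folklore] -/
theorem exists_generator_logMult : ∃ r₀ : ℝ, 0 ≤ r₀ ∧
    (logMultSubgroup k₀ M hlam hM : Set ℝ) = Set.range (fun n : ℤ ↦ n * r₀) := by
  by_cases hbot : logMultSubgroup k₀ M hlam hM = ⊥
  · refine ⟨0, le_rfl, ?_⟩
    rw [hbot]
    ext r; simp
  · -- a gap `(0, a)` free of elements of `L`, from finiteness of `{|ℓ| ≤ log 2}`
    have hfin := finite_abs_logMult_le k₀ hlam hM (by norm_num : (1 : ℝ) ≤ 2)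
    set P : Set ℝ := {r : ℝ | r ∈ logMultSubgroup k₀ M hlam hM ∧ 0 < r ∧ r ≤ Real.log 2} with hP
    have hPfin : P.Finite := by
      have : P ⊆ (logMult k₀ M) '' {γ : stabK k₀ | |logMult k₀ M γ| ≤ Real.log 2} := by
        rintro r ⟨⟨γ, rfl⟩, h0, h2⟩
        exact ⟨γ, abs_le.mpr ⟨by linarith, h2⟩, rfl⟩
      exact (hfin.image _).subset this
    obtain ⟨a, ha0, hdisj⟩ : ∃ a : ℝ, 0 < a ∧ Disjoint (logMultSubgroup k₀ M hlam hM : Set ℝ) (Ioo 0 a) := by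
      by_cases hPne : P.Nonempty
      · set a := hPfin.toFinset.min' ((Set.Finite.toFinset_nonempty hPfin).mpr hPne) with ha
        have haP : a ∈ P := by
          have := Finset.min'_mem hPfin.toFinset ((Set.Finite.toFinset_nonempty hPfin).mpr hPne)
          rwa [Set.Finite.mem_toFinset] at this
        refine ⟨a, haP.2.1, Set.disjoint_left.mpr fun r hr hra ↦ ?_⟩
        have hrP : r ∈ P := ⟨hr, hra.1, hra.2.le.trans haP.2.2⟩
        have : a ≤ r := Finset.min'_le _ _ ((Set.Finite.mem_toFinset hPfin).mpr hrP)
        linarith [hra.2]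
      · refine ⟨Real.log 2, Real.log_pos (by norm_num), Set.disjoint_left.mpr fun r hr hra ↦ ?_⟩
        exact hPne ⟨r, hr, hra.1, hra.2.le⟩
    obtain ⟨b, hb⟩ := AddSubgroup.exists_isLeast_pos hbot ha0 hdisj
    have hcyc := AddSubgroup.cyclic_of_min hb
    refine ⟨b, hb.1.2.le, ?_⟩
    rw [hcyc, ← AddSubgroup.zmultiples_eq_closure]
    ext r
    simp only [SetLike.mem_coe, AddSubgroup.mem_zmultiples_iff, Set.mem_range, zsmul_eq_mul]

end Cyclic

/-! ### Non-triviality of the stabiliser: the Pell automorph -/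

/-- The integer discriminant `Δ(k) = k₁² - 256 k₀ k₂` of `ι♮(k)`. [folklore] -/
def intDisc (k : Fin 3 → ℤ) : ℤ := k 1 ^ 2 - 256 * k 0 * k 2

/-- `disc ι♮(k) = Δ(k)`. [folklore] -/
theorem disc_latSharp_eq_intDisc (k : Fin 3 → ℤ) : disc (latSharp k) = (intDisc k : ℝ) := by
  rw [disc, latSharp_zero, latSharp_one, latSharp_two, intDisc]; push_cast; ring

/-- **The Pell automorph** of `ι♮(k₀) = (64k₀, k₁, k₂)` attached to `t² - Δ s² = 1`:
`P = (t - k₁ s, -2 k₂ s; 128 k₀ s, t + k₁ s) ∈ Γ₀(64)`. [folklore] -/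
def pellAut (k₀ : Fin 3 → ℤ) (t s : ℤ) (h : t ^ 2 - intDisc k₀ * s ^ 2 = 1) : SL(2, ℤ) :=
  ⟨!![t - k₀ 1 * s, -2 * k₀ 2 * s; 128 * k₀ 0 * s, t + k₀ 1 * s], by
    rw [Matrix.det_fin_two_of]
    rw [intDisc] at h
    linear_combination h⟩

/-- The Pell automorph stabilises the form. [folklore] -/
theorem actM_pellAut (k₀ : Fin 3 → ℤ) (t s : ℤ) (h : t ^ 2 - intDisc k₀ * s ^ 2 = 1) :
    actM (pellAut k₀ t s h) (latSharp k₀) = latSharp k₀ := by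
  rw [intDisc] at h
  have hR : (t : ℝ) ^ 2 - ((k₀ 1 : ℝ) ^ 2 - 256 * k₀ 0 * k₀ 2) * s ^ 2 = 1 := by exact_mod_cast h
  unfold actM pellAut
  ext i
  fin_cases i
  · simp [actV, latSharp]; linear_combination (64 * (k₀ 0 : ℝ)) * hR
  · simp [actV, latSharp]; linear_combination ((k₀ 1 : ℝ)) * hR
  · simp [actV, latSharp]; linear_combination ((k₀ 2 : ℝ)) * hR

/-- The Pell automorph lies in `Γ₀(64)`. [folklore] -/
theorem pellAut_mem_Gamma0 (k₀ : Fin 3 → ℤ) (t s : ℤ) (h : t ^ 2 - intDisc k₀ * s ^ 2 = 1) :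
    pellAut k₀ t s h ∈ Gamma0 64 := by
  rw [Gamma0_mem]
  show (((128 * k₀ 0 * s : ℤ)) : ZMod 64) = 0
  rw [show (128 * k₀ 0 * s : ℤ) = 64 * (2 * k₀ 0 * s) by ring, Int.cast_mul,
    show ((64 : ℤ) : ZMod 64) = 0 from rfl, zero_mul]

/-- Powers of a stabilising integer matrix stabilise. [folklore] -/
theorem actM_pow {P : SL(2, ℤ)} {x : V} (hP : actM P x = x) (n : ℕ) : actM (P ^ n) x = x := by
  induction n with
  | zero => rw [pow_zero, actM_one]
  | succ m ih => rw [pow_succ, ← actM_actM, ih, hP]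

section Package

variable (k₀ : Fin 3 → ℤ) {M : SL(2, ℝ)} {lam : ℝ} (hlam : lam ≠ 0) (hM : actSL M (latSharp k₀) = xyForm lam)
include hlam hM

/-- The multiplier of powers: `κ(P^n) = κ(P)^n` for stabilising `P`. [folklore] -/
theorem multK_pow {P : SL(2, ℝ)} (hP : actSL P (latSharp k₀) = latSharp k₀) (n : ℕ) :
    multK M (P ^ n) = multK M P ^ n := by
  induction n with
  | zero =>
    rw [pow_zero, pow_zero]
    unfold multK; rw [mul_one, inv_mul_cancel]; simp
  | succ m ih =>
    have hPm : actSL (P ^ m) (latSharp k₀) = latSharp k₀ := by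
      clear ih
      induction m with
      | zero => rw [pow_zero, actSL_one]
      | succ j ihj => rw [pow_succ, ← actSL_mul, ihj, hP]
    rw [pow_succ, multK_mul hlam hM hPm hP, ih, pow_succ]

/-- **The stabiliser is non-trivial when `Δ` is not a square** (the Pell automorph, raised to a
power lying in `Γ₀(64)⁺`). [folklore] -/
theorem exists_logMult_ne_zero (hpos : 0 < intDisc k₀) (hnsq : ¬ IsSquare (intDisc k₀)) :
    ∃ γ : stabK k₀, logMult k₀ M γ ≠ 0 := by
  obtain ⟨t, s, hts, hs⟩ := Pell.exists_of_not_isSquare hpos hnsq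
  set P : SL(2, ℤ) := pellAut k₀ t s hts with hPdef
  have hPx : actM P (latSharp k₀) = latSharp k₀ := actM_pellAut k₀ t s hts
  -- a power in `Γ₀(64)⁺`
  have hidx : (Gamma0Plus 64).index ≠ 0 := Subgroup.FiniteIndex.index_ne_zero
  obtain ⟨n, hn, -, hmem⟩ := Subgroup.exists_pow_mem_of_index_ne_zero hidx P
  have hfix : (⟨P ^ n, hmem⟩ : Gamma0Plus 64) • k₀ = k₀ := by
    rw [smul_eq_iff_actSL, Subgroup.coe_mk, actSL_coe]
    exact actM_pow hPx n
  refine ⟨⟨⟨P ^ n, hmem⟩, hfix⟩, fun h0 ↦ ?_⟩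
  -- `κ(P^n) = κ(P)^n = 1` forces `κ(P) = 1`, i.e. `P = ±1`, impossible as `s ≠ 0`
  have hPR : actSL (P : SL(2, ℝ)) (latSharp k₀) = latSharp k₀ := by rw [actSL_coe]; exact hPx
  have hk : multK M ((P : SL(2, ℝ)) ^ n) = 1 := by
    have := exp_logMult k₀ hlam hM ⟨⟨P ^ n, hmem⟩, hfix⟩
    rw [h0, Real.exp_zero] at this
    rw [← map_pow]
    exact this.symm
  rw [multK_pow k₀ hlam hM hPR] at hk
  have hKpos := multK_pos hlam hM hPR
  have hK1 : multK M (P : SL(2, ℝ)) = 1 := by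
    have hlog : (n : ℝ) * Real.log (multK M (P : SL(2, ℝ))) = 0 := by
      rw [← Real.log_pow, hk, Real.log_one]
    have hn' : (n : ℝ) ≠ 0 := by exact_mod_cast hn.ne'
    have : Real.log (multK M (P : SL(2, ℝ))) = 0 := by
      rcases mul_eq_zero.mp hlog with h | h
      · exact absurd h hn'
      · exact h
    rw [← Real.exp_log hKpos, this, Real.exp_zero]
  rcases eq_one_or_neg_one_of_multK_eq_one hlam hM hPR hK1 with h1 | h1
  · have hP1 : P = 1 := by
      have : (P : SL(2, ℝ)) = ((1 : SL(2, ℤ)) : SL(2, ℝ)) := by rw [map_one]; exact h1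
      exact eq_of_coe_real_eq this
    have := congrArg (fun g : SL(2, ℤ) ↦ (g 1 0 : ℤ)) hP1
    simp [hPdef, pellAut] at this
    -- `128 k₀ 0 s = 0` and then `-2 k₂ s = 0`: so `k₀ 0 = k₀ 2 = 0`... but then `Δ = k₁²` is a square
    have h01 := congrArg (fun g : SL(2, ℤ) ↦ (g 0 1 : ℤ)) hP1
    simp [hPdef, pellAut] at h01
    rcases this with h00 | hs0
    · rcases h01 with h02 | hs0
      · apply hnsq
        refine ⟨k₀ 1, ?_⟩
        rw [intDisc, h00, h02]; ring
      · exact hs hs0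
    · exact hs hs0
  · have hP1 : P = -1 := eq_neg_one_of_coe_real h1
    have := congrArg (fun g : SL(2, ℤ) ↦ (g 1 0 : ℤ)) hP1
    simp [hPdef, pellAut] at this
    have h01 := congrArg (fun g : SL(2, ℤ) ↦ (g 0 1 : ℤ)) hP1
    simp [hPdef, pellAut] at h01
    rcases this with h00 | hs0
    · rcases h01 with h02 | hs0
      · apply hnsq
        refine ⟨k₀ 1, ?_⟩
        rw [intDisc, h00, h02]; ring
      · exact hs hs0
    · exact hs hs0

/-- The matrix of `SL₂(ℝ)` with given entries. [folklore] -/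
def slOf (a b c d : ℝ) (hdet : a * d - b * c = 1) : SL(2, ℝ) :=
  ⟨!![a, b; c, d], by rw [Matrix.det_fin_two_of]; linarith⟩

omit hlam hM in
/-- `actSL (slOf …) = actV …`. [folklore] -/
theorem actSL_slOf (a b c d : ℝ) (hdet : a * d - b * c = 1) (x : V) :
    actSL (slOf a b c d hdet) x = actV a b c d x := rfl

end Package

/-- **The structure of the stabiliser of an anisotropic indefinite vector in `Γ₀(64)⁺`.**  For `k₀`
with `Δ(k₀) > 0` not a square there are `M ∈ SL₂(ℝ)` with `ι♮(k₀) ∘ M = λ XY` (`λ ≠ 0`), `κ₀ > 1`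
and a bijection `m : Γ_{k₀} → ℤ` such that every `γ ∈ Γ_{k₀}` acts, after conjugation by `M`, as
the homothety `M⁻¹(γ w) = κ₀^{m(γ)} · M⁻¹ w`.  (So `Γ_{k₀}` is infinite cyclic, generated by a
hyperbolic element whose axis is the geodesic joining the roots of the form.)
[cite: Shintani1975, §2, proof of Prop. 2.3 (pp. 103–104)] -/
theorem indef_stabilizer (k₀ : Fin 3 → ℤ) (hpos : 0 < intDisc k₀) (hnsq : ¬ IsSquare (intDisc k₀)) :
    ∃ (M : SL(2, ℝ)) (lam κ₀ : ℝ) (m : stabK k₀ → ℤ), lam ≠ 0 ∧ 1 < κ₀ ∧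
      actSL M (latSharp k₀) = xyForm lam ∧ Function.Bijective m ∧
      ∀ (γ : stabK k₀) (w : ℍ),
        (((M⁻¹ • ((((γ : Gamma0Plus 64) : SL(2, ℤ))) • w) : ℍ)) : ℂ) =
          ((κ₀ ^ (m γ) : ℝ) : ℂ) * (((M⁻¹ • w : ℍ)) : ℂ) := by
  have hposR : 0 < disc (latSharp k₀) := by rw [disc_latSharp_eq_intDisc]; exact_mod_cast hpos
  obtain ⟨a, b, c, d, lam, hdet, hlam, hconj⟩ := exists_conj_to_xyForm hposR
  set M : SL(2, ℝ) := slOf a b c d hdet with hMdef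
  have hM : actSL M (latSharp k₀) = xyForm lam := by rw [hMdef, actSL_slOf]; exact hconj
  -- the generator of the image of `ℓ`
  obtain ⟨r₀, hr₀, hL⟩ := exists_generator_logMult k₀ hlam hM
  have hr₀pos : 0 < r₀ := by
    rcases lt_or_eq_of_le hr₀ with h | h
    · exact h
    · exfalso
      obtain ⟨γ, hγ⟩ := exists_logMult_ne_zero k₀ hlam hM hpos hnsq
      have hmem : logMult k₀ M γ ∈ (logMultSubgroup k₀ M hlam hM : Set ℝ) := ⟨γ, rfl⟩
      rw [hL, ← h] at hmem
      obtain ⟨n, hn⟩ := hmem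
      simp at hn
      exact hγ hn.symm
  -- `m γ`: the integer with `ℓ(γ) = m γ · r₀`
  have hex : ∀ γ : stabK k₀, ∃ n : ℤ, (n : ℝ) * r₀ = logMult k₀ M γ := by
    intro γ
    have hmem : logMult k₀ M γ ∈ (logMultSubgroup k₀ M hlam hM : Set ℝ) := ⟨γ, rfl⟩
    rw [hL] at hmem
    exact hmem
  choose m hm using hex
  refine ⟨M, lam, Real.exp r₀, m, hlam, by simpa using hr₀pos, hM, ⟨?_, ?_⟩, ?_⟩
  · intro γ γ' h
    apply logMult_injective k₀ hlam hM
    rw [← hm γ, ← hm γ', h]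
  · intro n
    have hmem : (n : ℝ) * r₀ ∈ (logMultSubgroup k₀ M hlam hM : Set ℝ) := by rw [hL]; exact ⟨n, rfl⟩
    obtain ⟨γ, hγ⟩ := hmem
    refine ⟨γ, ?_⟩
    have := hm γ
    rw [hγ] at this
    have h2 : ((m γ : ℤ) : ℝ) = n := mul_right_cancel₀ hr₀pos.ne' this
    exact_mod_cast h2
  · intro γ w
    have h := coe_inv_smul_smul hlam hM (actSL_toSLR k₀ γ) w
    rw [show ((((γ : Gamma0Plus 64) : SL(2, ℤ))) • w) = (toSLR k₀ γ) • w from rfl, h,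
      ← exp_logMult k₀ hlam hM γ, ← hm γ, ← Real.rpow_intCast, ← Real.exp_mul, mul_comm ((m γ : ℤ) : ℝ) r₀]

end Literature.NumberTheory.EllipticCurves.Shintani
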